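import Mathlib.Analysis.SpecialFunctions.Log.Summable
import Mathlib.Analysis.Asymptotics.SpecificAsymptotics
import Mathlib.Analysis.SpecificLimits.Normed
import Mathlib.Algebra.BigOperators.Field
import Literature.NumberTheory.Automorphic.AutomorphicLFunction
import Literature.NumberTheory.LFunctions.DedekindZeta
import HarnessLib

/-!
# Convergence of the standard Euler product of `GL_n`: reductions and named inputs
(companion to `Literature.NumberTheory.Automorphic.AutomorphicLFunction`)

The named fact `StandardLFunctionData.multipliable_L` of `AutomorphicLFunction` (the full Euler
product `∏_v P_v(q_v^{-s})⁻¹` of a standard L-function datum `D` of a cuspidal `Π` on `GL_n(𝔸_K)`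
is multipliable for `re s > 1`) is, over the tree's honest definitions (`CuspidalAutomorphicRepGL`
= irreducible closed subrepresentations of `L²_cusp`, Satake parameters = spherical Hecke
eigenvalues, `HasSatakeParameterAt`), exactly the theorem of Jacquet–Shalika, *On Euler products
and the classification of automorphic representations I*, Amer. J. Math. **103** (1981) 499–558,
Thm. (5.3) with Remark (5.4) (case `p = 1`, `π' = 1`), whose printed proof rests on

* the local bound `|μ_{j,v}| ≤ q_v^{1/2}` on the Satake parameters of the (generic, unitary,
  unramified) local components of a cusp form (loc. cit. Cor. (2.5), Remark (2.6)(3), (5.1.3));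
* the analytic continuation of `L_S(s, π × π̄)` to `re s > 1` (loc. cit. Lemma (5.2), from the
  Rankin–Selberg integral against an Eisenstein series, §4) and Landau's lemma on Dirichlet
  series with non-negative coefficients, giving convergence of
  `∑_{v ∉ S} ∑_{n ≥ 1} |tr A_v^n|² / (n q_v^{n s})` for `re s > 1` (loc. cit. (5.3.3)–(5.3.4));
* Cauchy–Schwarz (loc. cit. (5.3.5)).

None of the local (Whittaker models, Bernstein–Zelevinsky) or global (Eisenstein series on
`GL_n`) theory is in Mathlib, so this file records the *architecture* of the printed proof:

* `StandardLFunctionData.multipliable_L_of_multipliable_partialStandardL` (**proved**): the full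
  product is multipliable as soon as the partial product off the finite exceptional set `D.S` is
  (`multipliable_partialStandardL` of `AutomorphicLFunction`); the finitely many free factors at
  `v ∈ D.S` are harmless (`Multipliable.mul_compl`, `Finset.multipliable`).
* `absolutelyConvergent_partialStandardL` (**named fact**, Jacquet–Shalika Thm. (5.3) and
  Remark (5.4) as printed: *absolute* convergence `∑_{v ∉ S} ‖L(s, Π_v) - 1‖ < ∞` on `re s > 1`),
  and `multipliable_partialStandardL_of_absolutelyConvergent` (**proved**): absolute convergence
  implies unconditional convergence in the complete normed field `ℂ`
  (Mathlib `multipliable_one_add_of_summable`).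
* hence `StandardLFunctionData.multipliable_L_of_absolutelyConvergent` (**proved**).

One level down, `absolutelyConvergent_partialStandardL` is in turn derived from the two inputs of
the printed proof of Thm. (5.3) (case `p = 1`, `π' = 1` of Remark (5.4)):

* `norm_satakeParameter_le_sqrt` (**named fact**, loc. cit. (5.1.3), from Cor. (2.5) and
  Remark (2.6)(3): `|μ_{j,v}| ≤ q_v^{1/2}` for the Satake parameters of a cusp form at an unramified
  place);
* `summable_normSq_trace_satakePow` (**named fact**, loc. cit. (5.3.3)–(5.3.4): the Dirichlet
  series `∑_{v ∉ S} ∑_{k ≥ 1} |tr A_v^k|² / (k q_v^{kσ})` with non-negative coefficients converges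
  for `σ > 1` — in print a consequence of Lemma (5.2) and Landau's lemma);
* `absolutelyConvergent_partialStandardL_of_JS` (**proved**, the rest of the printed proof): the
  first-order expansion `‖∏_{a ∈ α v}(1 - a q_v^{-s}) - 1‖ ≤ |tr A_v|² q_v^{-σ} + q_v^{-σ} +
  4^n q_v^{1-2σ}` (`norm_eval_eulerPolynomial_sub_one_le_of_sqrt`, elementary: induction on the
  multiset, the bound (5.1.3) on the remainder, and `|tr A_v| ≤ |tr A_v|² + 1`, i.e. the
  Cauchy–Schwarz step (5.3.5) with `π' = 1`), summability of the right side over `v` from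
  (5.3.3) (terms `k = 1`) and `∑_v q_v^{-t} < ∞` for `t > 1` (`summable_residueCard_rpow_neg`,
  from the tree's `Literature.NumberTheory.LFunctions.LSeriesSummable_dedekindZeta` regrouped over ideals of given norm and
  restricted to primes), and passage to the inverted factors (`summable_norm_inv_sub_one`);
* hence `multipliable_partialStandardL_of_JS` and `StandardLFunctionData.multipliable_L_of_JS`
  (**proved**).

Finally the first input is itself a consequence of the second: if the power sums
`p_j = ∑_i v_i^j` of finitely many complex numbers satisfy `|p_j|² ≤ A j^d R^{2j}` for all
`j ≥ 1`, then `|v_i| ≤ R` for all `i` (`norm_le_of_normSq_powerSum_le`, **proved**: with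
`ρ = max_i |v_i|` the Cesàro means of `|p_j|² / ρ^{2j} = ∑_{i,i'} (v_i v̄_{i'} / ρ²)^j` tend to
the number of pairs `(i, i')` with `v_i v̄_{i'} = ρ²`, which is `≥ 1`, so `ρ ≤ R`); the terms of
the convergent series (5.3.3) at `σ > 1` are bounded, so `|tr A_v^j|² ≤ T j q_v^{jσ}` and
`|μ_{j,v}| ≤ q_v^{σ/2}` for every `σ > 1`, i.e. `|μ_{j,v}| ≤ q_v^{1/2}`
(`norm_satakeParameter_le_sqrt_of_summable`, **proved** — the classical remark that the
convergence of `L_S(s, π × π̄)` on `re s > 1` already yields the bound (5.1.3)). Hence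
`absolutelyConvergent_partialStandardL_of_summable`, `multipliable_partialStandardL_of_summable`
and `StandardLFunctionData.multipliable_L_of_summable` (**proved**): over the tree's honest
definitions, `multipliable_L` rests on the *single* printed statement (5.3.3)–(5.3.4) of the
source (`summable_normSq_trace_satakePow`), whose printed proof is Lemma (5.2) (Rankin–Selberg:
continuation of `L_S(s, π × π̄)` to `re s > 1`, from the integral representation of §4 against a
mirabolic Eisenstein series) and Landau's lemma. From the same single input we also derive the
"in particular" of Thm. (5.3), the non-vanishing of `L^S(s, Π)` on `re s > 1`
(`partialStandardL_ne_zero_of_summable`, **proved**: an absolutely convergent product of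
non-zero factors), and the sibling named fact `StandardLFunctionData.L_eq_partialStandardL_mul`
of `AutomorphicLFunction` (`L_eq_partialStandardL_mul_of_summable`, **proved**: splitting a
`tprod` whose restrictions to `D.S` and to its complement are multipliable).

The named inputs are recorded in this companion file, next to the reductions that consume them,
so that the interface of `AutomorphicLFunction` stays untouched; whoever discharges Thm. (5.3)
should discharge `summable_normSq_trace_satakePow` (or directly
`absolutelyConvergent_partialStandardL`) and derive `norm_satakeParameter_le_sqrt`,
`multipliable_partialStandardL` and `multipliable_L` through the theorems below, not
independently.

## References

* H. Jacquet, J. A. Shalika, *On Euler products and the classification of automorphic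
  representations I*, Amer. J. Math. 103 (1981), 499–558 [JacquetShalikaAJM1981]: Cor. (2.5)
  p. 515; (5.1.3) p. 554; Lemma (5.2) p. 554; Thm. (5.3) p. 555; Remark (5.4) p. 557.
* N. Bourbaki, *Topologie générale*, Ch. VIII (commutative vs. absolute convergence of infinite
  products in `ℂ`, cited as [N.B.] loc. cit. p. 557).
* S. Lang, *Algebraic Number Theory*, VIII §2 (convergence of `ζ_K(σ)`, `σ > 1`).
-/

noncomputable section

open scoped MatrixGroups
open NumberField IsDedekindDomain MeasureTheory Polynomial Complex Filter

namespace Literature.NumberTheory.Automorphic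

section Cuspidal

variable {n : ℕ} {K : Type} [Field K] [NumberField K]
  {μ : Measure (AdelicGroupData.gl n K).automorphicQuotient}
  [(AdelicGroupData.gl n K).IsAutomorphicMeasure μ]

/-- **Jacquet–Shalika: absolute convergence of the standard Euler product** (as printed). For a
(unitary) cuspidal automorphic representation `Π` of `GL_n(𝔸_K)` and its Satake family `α` away
from `S` (so `L(s, Π_v) = det(1 - A_v q_v^{-s})⁻¹ = (∏_{a ∈ α v} (1 - a q_v^{-s}))⁻¹` for
`v ∉ S`), the infinite product `L_S(s, Π) = ∏_{v ∉ S} L(s, Π_v)` is *absolutely convergent* in the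
half-plane `re s > 1`, i.e. `∑_{v ∉ S} ‖L(s, Π_v) - 1‖ < ∞` (Jacquet–Shalika (1981), Thm. (5.3):
"`L_S(s, π × π')` is absolutely convergent in the half-plane `Re(s) > 1`" for unitary cuspidal
`π`, `π'`, applied as in their Remark (5.4) to `p = 1`, `π' = 1`, where
`L_S(s, π × π') = ∏_{v ∉ S} det(1 - A_v q_v^{-s})⁻¹ = L_S(s, π)`; cuspidal representations in
`L²(GL_n(K) A_G \ GL_n(𝔸_K))` are unitary, outline D10). The theorem is printed for `S` finite
containing the ramified places; the statement for an arbitrary `S` off which `Π` has Satake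
parameters follows (sub-products, and finitely many extra factors). Whether the tree's Hecke
normalisation (`t_{v,i} = diag(ϖ, …, ϖ, 1, …, 1)` acting through `rightRegular`) makes `α v` the
class `A_v` of `Π_v` or its inverse (the class of the contragredient `Π̃_v`), the statement is
covered, `Π̃` being cuspidal unitary with `Π`. Unconditional convergence (`Multipliable`,
`multipliable_partialStandardL`) follows: `multipliable_partialStandardL_of_absolutelyConvergent`.
[cite: JacquetShalikaAJM1981, Thm. (5.3), Remark (5.4)] -/
def absolutelyConvergent_partialStandardL : Prop :=
  ∀ (P : CuspidalAutomorphicRepGL n K μ) {S : Set (HeightOneSpectrum (𝓞 K))} {α : SatakeFamily K}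
    (_hα : IsSatakeFamilyOf P S α) {s : ℂ} (_hs : 1 < s.re),
    Summable fun v : {v : HeightOneSpectrum (𝓞 K) // v ∉ S} =>
      ‖((eulerPolynomial (α v.1)).eval ((v.1.residueCard : ℂ) ^ (-s)))⁻¹ - 1‖

/-- Absolute convergence of the partial standard Euler product (Jacquet–Shalika (1981),
Thm. (5.3)) implies its unconditional convergence in `ℂ` (`multipliable_partialStandardL`): in a
complete normed ring `∑ ‖f_v‖ < ∞` makes `∏ (1 + f_v)` multipliable (Mathlib
`multipliable_one_add_of_summable`; Bourbaki, *Top. gén.* VIII, as cited loc. cit. p. 557).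
[folklore] -/
theorem multipliable_partialStandardL_of_absolutelyConvergent
    (h : absolutelyConvergent_partialStandardL (μ := μ)) :
    multipliable_partialStandardL (μ := μ) := by
  intro P S α hα s hs
  have hsum := h P hα hs
  refine (multipliable_one_add_of_summable hsum).congr fun v => ?_
  simp only [add_sub_cancel]

end Cuspidal

namespace StandardLFunctionData

variable {n : ℕ} {K : Type} [Field K] [NumberField K]
  {μ : Measure (AdelicGroupData.gl n K).automorphicQuotient}
  [(AdelicGroupData.gl n K).IsAutomorphicMeasure μ] {P : CuspidalAutomorphicRepGL n K μ}

/-- **Reduction of `multipliable_L` to the partial product.** If the partial standard Euler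
product of every Satake family of a cuspidal `Π` is multipliable on `re s > 1`
(`multipliable_partialStandardL`, Jacquet–Shalika (1981), Thm. (5.3)), then so is the full Euler
product `∏_v P_v(q_v^{-s})⁻¹` of every standard L-function datum `D` of `Π`: off the finite set
`D.S` the local factors of `D` *are* the Satake Euler polynomials (`localFactor_of_not_mem`), and a
product over all finite places is multipliable as soon as its restrictions to a set and to its
complement are (Mathlib `Multipliable.mul_compl`), the restriction to the finite set `D.S` being
trivially multipliable (`Finset.multipliable`). [folklore] -/
theorem multipliable_L_of_multipliable_partialStandardL
    (h : multipliable_partialStandardL (μ := μ)) : multipliable_L (P := P) := by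
  intro D s hs
  refine Multipliable.mul_compl (s := (↑D.S : Set (HeightOneSpectrum (𝓞 K))))
    (D.S.multipliable _) ?_
  have hpart := h P D.isSatakeFamily (s := s) hs
  refine hpart.congr fun v => ?_
  simp only [Function.comp_apply, D.localFactor_of_not_mem v.1 (by simpa using v.2)]

/-- Hence `multipliable_L` follows from the single named input
`absolutelyConvergent_partialStandardL` (Jacquet–Shalika (1981), Thm. (5.3), Remark (5.4)).
[folklore] -/
theorem multipliable_L_of_absolutelyConvergent
    (h : absolutelyConvergent_partialStandardL (μ := μ)) : multipliable_L (P := P) :=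
  multipliable_L_of_multipliable_partialStandardL
    (multipliable_partialStandardL_of_absolutelyConvergent h)

end StandardLFunctionData


/-! ### Dedekind: `∑_v q_v^{-σ} < ∞` for `σ > 1` -/

section Dedekind

variable {K : Type*} [Field K] [NumberField K]

/-- `∑_{I ⊆ 𝓞 K} N(I)^{-σ} < ∞` for `σ > 1` (the Dirichlet series of `ζ_K` converges absolutely on
`re s > 1`, `Literature.NumberTheory.LFunctions.LSeriesSummable_dedekindZeta`, regrouped by the value of the norm; the zero
ideal contributes `0^{-σ} = 0`). Lang, *ANT* VIII §2, Thm. 5. [folklore] -/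
theorem summable_absNorm_rpow_neg {σ : ℝ} (hσ : 1 < σ) :
    Summable fun I : Ideal (𝓞 K) => (Ideal.absNorm I : ℝ) ^ (-σ) := by
  have hL := Literature.NumberTheory.LFunctions.LSeriesSummable_dedekindZeta (K := K) (s := (σ : ℂ)) (by simpa using hσ)
  have hg : Summable fun n : ℕ =>
      (Nat.card {I : Ideal (𝓞 K) // Ideal.absNorm I = n} : ℝ) * (n : ℝ) ^ (-σ) := by
    refine hL.norm.congr fun n => ?_
    rw [LSeries.norm_term_eq]
    rcases eq_or_ne n 0 with rfl | hn
    · simp [Real.zero_rpow (neg_ne_zero.mpr (by positivity : σ ≠ 0))]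
    · simp [hn, Real.rpow_neg (Nat.cast_nonneg n), div_eq_mul_inv]
  have h0 : (0 : Ideal (𝓞 K) → ℝ) ≤ fun I => (Ideal.absNorm I : ℝ) ^ (-σ) := fun I => by
    positivity
  refine ((summable_partition h0 (s := fun n : ℕ => {I : Ideal (𝓞 K) | Ideal.absNorm I = n})
    fun I => ⟨Ideal.absNorm I, rfl, fun n hn => hn.symm⟩).mpr ⟨fun n => ?_, ?_⟩)
  · haveI := (Ideal.finite_setOf_absNorm_eq (S := 𝓞 K) n).to_subtype
    exact Summable.of_finite
  · refine hg.congr fun n => ?_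
    haveI : Fintype ↥{I : Ideal (𝓞 K) | Ideal.absNorm I = n} :=
      (Ideal.finite_setOf_absNorm_eq (S := 𝓞 K) n).fintype
    rw [tsum_fintype, Finset.sum_congr rfl fun (i : ↥{I : Ideal (𝓞 K) | Ideal.absNorm I = n}) _ =>
      show (Ideal.absNorm i.1 : ℝ) ^ (-σ) = (n : ℝ) ^ (-σ) by
        rw [show Ideal.absNorm i.1 = n from i.2],
      Finset.sum_const, Finset.card_univ, nsmul_eq_mul, ← Set.coe_setOf, Nat.card_eq_fintype_card]

/-- `∑_v q_v^{-σ} < ∞` for `σ > 1`, the sum over the finite places `v` of the number field `K`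
(`q_v = N(v) = v.residueCard`): the prime terms of the previous sum (Lang, *ANT* VIII §2).
[folklore] -/
theorem summable_residueCard_rpow_neg {σ : ℝ} (hσ : 1 < σ) :
    Summable fun v : HeightOneSpectrum (𝓞 K) => (v.residueCard : ℝ) ^ (-σ) :=
  (summable_absNorm_rpow_neg hσ).comp_injective
    (i := fun v : HeightOneSpectrum (𝓞 K) => v.asIdeal) fun _ _ h => HeightOneSpectrum.ext h

end Dedekind

/-! ### An elementary estimate for Euler polynomials -/

section EulerBound

/-- For `‖a‖ ≤ B` (`a ∈ α`), `‖x‖ ≤ t` and `B t ≤ 1`: `‖∏_{a ∈ α} (1 - a x) - 1‖ ≤ (2^m - 1) B t`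
and `‖∏_{a ∈ α} (1 - a x) - 1 + (∑ α) x‖ ≤ 4^m (B t)²`, `m = card α` (first-order Taylor
remainder of the Euler polynomial; induction on `α`). [folklore] -/
theorem norm_eval_eulerPolynomial_sub_one_le {B t : ℝ} (hB : 0 ≤ B) {x : ℂ} (hx : ‖x‖ ≤ t)
    (hBt : B * t ≤ 1) (α : Multiset ℂ) (hα : ∀ a ∈ α, ‖a‖ ≤ B) :
    ‖(eulerPolynomial α).eval x - 1‖ ≤ (2 ^ Multiset.card α - 1) * (B * t) ∧
      ‖(eulerPolynomial α).eval x - 1 + α.sum * x‖ ≤ 4 ^ Multiset.card α * (B * t) ^ 2 := by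
  induction α using Multiset.induction_on with
  | empty => exact ⟨by simp, by simpa using sq_nonneg (B * t)⟩
  | cons a α ih =>
    obtain ⟨ih1, ih2⟩ := ih fun b hb => hα b (Multiset.mem_cons_of_mem hb)
    have ha : ‖a‖ ≤ B := hα a (Multiset.mem_cons_self a α)
    have ht : 0 ≤ t := (norm_nonneg x).trans hx
    have hu : 0 ≤ B * t := mul_nonneg hB ht
    have hax : ‖a * x‖ ≤ B * t := by
      rw [norm_mul]; exact mul_le_mul ha hx (norm_nonneg _) hB
    have h1ax : ‖1 - a * x‖ ≤ 1 + B * t :=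
      (norm_sub_le _ _).trans (by rw [norm_one]; gcongr)
    have h2m : (1 : ℝ) ≤ 2 ^ Multiset.card α := one_le_pow₀ (by norm_num)
    have h24 : (2 : ℝ) ^ Multiset.card α ≤ 4 ^ Multiset.card α :=
      pow_le_pow_left₀ (by norm_num) (by norm_num) _
    set F := (eulerPolynomial α).eval x with hF
    have hF' : (eulerPolynomial (a ::ₘ α)).eval x = (1 - a * x) * F := by simp [hF]
    rw [hF', Multiset.card_cons, Multiset.sum_cons, pow_succ, pow_succ]
    constructor
    · have : (1 - a * x) * F - 1 = (1 - a * x) * (F - 1) - a * x := by ring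
      rw [this]
      calc ‖(1 - a * x) * (F - 1) - a * x‖ ≤ ‖1 - a * x‖ * ‖F - 1‖ + ‖a * x‖ := by
            refine (norm_sub_le _ _).trans ?_
            rw [norm_mul]
        _ ≤ (1 + B * t) * ((2 ^ Multiset.card α - 1) * (B * t)) + B * t := by
            gcongr
        _ ≤ (2 ^ Multiset.card α * 2 - 1) * (B * t) := by
            nlinarith [mul_nonneg (sub_nonneg.mpr h2m) (mul_nonneg hu (sub_nonneg.mpr hBt))]
    · have : (1 - a * x) * F - 1 + (a + α.sum) * x = (F - 1 + α.sum * x) - a * x * (F - 1) := by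
        ring
      rw [this]
      calc ‖F - 1 + α.sum * x - a * x * (F - 1)‖ ≤ ‖F - 1 + α.sum * x‖ + ‖a * x‖ * ‖F - 1‖ := by
            refine (norm_sub_le _ _).trans ?_
            rw [norm_mul]
        _ ≤ 4 ^ Multiset.card α * (B * t) ^ 2 + B * t * ((2 ^ Multiset.card α - 1) * (B * t)) := by
            gcongr
        _ ≤ 4 ^ Multiset.card α * 4 * (B * t) ^ 2 := by
            nlinarith [sq_nonneg (B * t)]

/-- The local estimate behind Jacquet–Shalika's Thm. (5.3) for one Euler factor: if all `a ∈ α`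
have `‖a‖ ≤ q^{1/2}` and `re s ≥ 1/2`, then
`‖∏_{a ∈ α} (1 - a q^{-s}) - 1‖ ≤ ‖∑ α‖² q^{-re s} + q^{-re s} + 4^{card α} q^{1 - 2 re s}`
(first-order remainder plus `‖∑ α‖ ≤ ‖∑ α‖² + 1`). [folklore] -/
theorem norm_eval_eulerPolynomial_sub_one_le_of_sqrt {α : Multiset ℂ} {q : ℕ} (hq : 1 < q)
    (hα : ∀ a ∈ α, ‖a‖ ≤ Real.sqrt q) {s : ℂ} (hs : 1 / 2 ≤ s.re) :
    ‖(eulerPolynomial α).eval ((q : ℂ) ^ (-s)) - 1‖ ≤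
      ‖α.sum‖ ^ 2 * (q : ℝ) ^ (-s.re) + (q : ℝ) ^ (-s.re) +
        4 ^ Multiset.card α * (q : ℝ) ^ (1 - 2 * s.re) := by
  have hq0 : (0 : ℝ) < q := by exact_mod_cast (zero_lt_one.trans hq)
  set x : ℂ := (q : ℂ) ^ (-s) with hx
  have hxnorm : ‖x‖ = (q : ℝ) ^ (-s.re) := by
    rw [hx, norm_natCast_cpow_of_pos (zero_lt_one.trans hq), neg_re]
  have hBt : Real.sqrt q * (q : ℝ) ^ (-s.re) ≤ 1 := by
    rw [Real.sqrt_eq_rpow, ← Real.rpow_add hq0]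
    exact Real.rpow_le_one_of_one_le_of_nonpos (by exact_mod_cast hq.le) (by linarith)
  have hsq : (Real.sqrt q * (q : ℝ) ^ (-s.re)) ^ 2 = (q : ℝ) ^ (1 - 2 * s.re) := by
    rw [mul_pow, Real.sq_sqrt hq0.le, ← Real.rpow_natCast, ← Real.rpow_mul hq0.le,
      show (q : ℝ) ^ (1 - 2 * s.re) = (q : ℝ) ^ (1 : ℝ) * (q : ℝ) ^ (-s.re * (2 : ℕ)) by
        rw [← Real.rpow_add hq0]; congr 1; push_cast; ring,
      Real.rpow_one]
  obtain ⟨-, h2⟩ :=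
    norm_eval_eulerPolynomial_sub_one_le (Real.sqrt_nonneg _) hxnorm.le hBt α hα
  have hpos : 0 ≤ (q : ℝ) ^ (-s.re) := Real.rpow_nonneg hq0.le _
  have hsum : ‖α.sum‖ ≤ ‖α.sum‖ ^ 2 + 1 := by
    nlinarith [norm_nonneg α.sum, sq_nonneg (‖α.sum‖ - 1)]
  calc ‖(eulerPolynomial α).eval x - 1‖
        = ‖((eulerPolynomial α).eval x - 1 + α.sum * x) - α.sum * x‖ := by rw [add_sub_cancel_right]
    _ ≤ ‖(eulerPolynomial α).eval x - 1 + α.sum * x‖ + ‖α.sum * x‖ := norm_sub_le _ _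
    _ ≤ 4 ^ Multiset.card α * (q : ℝ) ^ (1 - 2 * s.re) + ‖α.sum‖ * (q : ℝ) ^ (-s.re) := by
        rw [norm_mul, hxnorm, ← hsq]
        gcongr
    _ ≤ 4 ^ Multiset.card α * (q : ℝ) ^ (1 - 2 * s.re) + (‖α.sum‖ ^ 2 + 1) * (q : ℝ) ^ (-s.re) := by
        gcongr
    _ = _ := by ring

/-- If `‖F_i - 1‖ ≤ b_i` with `∑ b_i < ∞`, then `∑ ‖F_i⁻¹ - 1‖ < ∞`: eventually `b_i ≤ 1/2`, where
`‖F_i‖ ≥ 1/2` and `‖F_i⁻¹ - 1‖ = ‖1 - F_i‖ / ‖F_i‖ ≤ 2 b_i` (absolute convergence of a product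
passes to the product of inverses). [folklore] -/
theorem summable_norm_inv_sub_one {ι : Type*} {F : ι → ℂ} {b : ι → ℝ} (hb : Summable b)
    (hle : ∀ i, ‖F i - 1‖ ≤ b i) : Summable fun i => ‖(F i)⁻¹ - 1‖ := by
  have hev : ∀ᶠ i in cofinite, b i < 1 / 2 :=
    hb.tendsto_cofinite_zero.eventually (gt_mem_nhds (by norm_num))
  refine Summable.of_norm_bounded_eventually (hb.mul_left 2) ?_
  filter_upwards [hev] with i hi
  rw [Real.norm_of_nonneg (norm_nonneg _)]
  have hb0 : 0 ≤ b i := (norm_nonneg _).trans (hle i)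
  have h1 : ‖F i - 1‖ ≤ 1 / 2 := (hle i).trans hi.le
  have hF : 1 / 2 ≤ ‖F i‖ := by
    have := norm_sub_norm_le 1 (F i)
    rw [norm_one, norm_sub_rev] at this
    linarith
  have hF0 : F i ≠ 0 := by
    intro h
    rw [h, norm_zero] at hF
    linarith
  have : (F i)⁻¹ - 1 = -(F i - 1) / F i := by
    field_simp
    ring
  rw [this, norm_div, norm_neg, div_le_iff₀ (by linarith)]
  calc ‖F i - 1‖ ≤ b i := hle i
    _ = 2 * b i * (1 / 2) := by ring
    _ ≤ 2 * b i * ‖F i‖ := by gcongr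

end EulerBound

/-! ### Jacquet–Shalika's inputs and the assembly -/

section Cuspidal

variable {n : ℕ} {K : Type} [Field K] [NumberField K]
  {μ : Measure (AdelicGroupData.gl n K).automorphicQuotient}
  [(AdelicGroupData.gl n K).IsAutomorphicMeasure μ]

/-- **Jacquet–Shalika's bound on the Satake parameters of a cusp form** ((5.1.3), recorded
non-strictly):
for a (unitary) cuspidal automorphic representation `Π` of `GL_n(𝔸_K)` and a place `v` at which
`Π` is unramified, with `A_v = diag(μ_{1,v}, …, μ_{n,v})` the Satake class of `Π_v`,
`|μ_{j,v}| ≤ q_v^{1/2}` for all `j` — from loc. cit. Cor. (2.5) ("Let `π` be an admissible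
irreducible representation of `G_r`. Suppose `π` is unitary, generic and unramified. Let `A` be the
class of `π`. Then the eigenvalues of `A` are in absolute value `< q^{1/2}`") and Remark (2.6)(3)
("the corollary applies to local components of cusp forms"). Stated over the tree's honest Satake
families (`IsSatakeFamilyOf`: `α v` is the multiset of Hecke–Satake parameters of `Π` at `v ∉ S`,
normalised by `T_{v,i} ↦ q_v^{i(n-i)/2} e_i(α v)` as in `HasSatakeParameterAt`, i.e. the class
`A_v` of `Π_v` or, depending on the left/right convention, `A_v⁻¹ = ` the class of `Π̃_v`; the
bound is printed for every unitary generic unramified `π`, so covers both, `Π̃` being cuspidal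
unitary with `Π`). [cite: JacquetShalikaAJM1981, (5.1.3), Cor. (2.5), Remark (2.6)(3)] -/
def norm_satakeParameter_le_sqrt : Prop :=
  ∀ (P : CuspidalAutomorphicRepGL n K μ) {S : Set (HeightOneSpectrum (𝓞 K))} {α : SatakeFamily K}
    (_hα : IsSatakeFamilyOf P S α) {v : HeightOneSpectrum (𝓞 K)} (_hv : v ∉ S) {a : ℂ}
    (_ha : a ∈ α v), ‖a‖ ≤ Real.sqrt v.residueCard

/-- **Jacquet–Shalika, convergence of `log L_S(σ, π × π̄)`** (as printed, (5.3.3)–(5.3.4) in the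
proof of Thm. (5.3)): for a (unitary) cuspidal automorphic representation `Π` of `GL_n(𝔸_K)`, the
Dirichlet series with non-negative coefficients
`f(s) = ∑_{v ∉ S} ∑_{k ≥ 1} |tr A_v^k|² / (k q_v^{k s})` (`A_v` the Satake class of `Π_v`,
`tr A_v^k = ∑_j μ_{j,v}^k`) "converges for `Re(s) > 1`" (loc. cit. p. 556: its abscissa of
convergence `a` satisfies `a ≤ 1`, by Lemma (5.2) — analytic continuation of `L_S(s, π × π̄)` to
`re s > 1`, from the Rankin–Selberg integral of §4 — and Landau's lemma on Dirichlet series with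
non-negative coefficients, [E.C.T.] = Titchmarsh, *The theory of functions*). Stated at real
`σ > 1` (equivalent, the coefficients being `≥ 0`) as summability over `ℕ × {v ∉ S}` (index `k`
for the exponent `k + 1`), over the tree's honest Satake families; `|tr A_v^k|²` is the same for
`A_v`, `Ā_v` and (unitarity: `Ā_v ∼ A_v⁻¹`) `A_v⁻¹`, so the statement does not depend on the
normalisation of `α v`. Printed for `S` finite ⊇ the ramified places (and large); for arbitrary
`S` off which `Π` has Satake parameters it follows (sub-series of a series of non-negative terms,
and finitely many extra places each contributing a series convergent for `σ > 1` by (5.1.3):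
`|tr A_v^k|² ≤ n² q_v^k`).
[cite: JacquetShalikaAJM1981, Thm. (5.3), proof, (5.3.3)–(5.3.4)] -/
def summable_normSq_trace_satakePow : Prop :=
  ∀ (P : CuspidalAutomorphicRepGL n K μ) {S : Set (HeightOneSpectrum (𝓞 K))} {α : SatakeFamily K}
    (_hα : IsSatakeFamilyOf P S α) {σ : ℝ} (_hσ : 1 < σ),
    Summable fun kv : ℕ × {v : HeightOneSpectrum (𝓞 K) // v ∉ S} =>
      ‖((α kv.2.1).map (· ^ (kv.1 + 1))).sum‖ ^ 2 /
        ((kv.1 + 1 : ℝ) * (kv.2.1.residueCard : ℝ) ^ ((kv.1 + 1 : ℝ) * σ))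

/-- **Jacquet–Shalika's proof of Thm. (5.3) (case `π' = 1`), assembled.** The bound (5.1.3) on
the Satake parameters and the convergence (5.3.3)–(5.3.4) of `∑_v ∑_k |tr A_v^k|²/(k q_v^{kσ})`
for `σ > 1` imply the absolute convergence `∑_{v ∉ S} ‖L(s, Π_v) - 1‖ < ∞` of the partial standard
Euler product on `re s > 1` (`absolutelyConvergent_partialStandardL`): with `x = q_v^{-s}`,
`σ = re s`, `‖∏_{a ∈ α v}(1 - a x) - 1‖ ≤ |tr A_v|² q_v^{-σ} + q_v^{-σ} + 4^n q_v^{1-2σ}`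
(`norm_eval_eulerPolynomial_sub_one_le_of_sqrt`, i.e. Cauchy–Schwarz on the first-order term as
in loc. cit. (5.3.5), and (5.1.3) on the remainder), the right side being summable over `v` by
(5.3.3) (terms `k = 1`) and `∑_v q_v^{-t} < ∞` for `t > 1` (`summable_residueCard_rpow_neg`,
Dedekind); inverting the factors preserves absolute convergence (`summable_norm_inv_sub_one`).
[cite: JacquetShalikaAJM1981, Thm. (5.3), Remark (5.4)] -/
theorem absolutelyConvergent_partialStandardL_of_JS (h₁ : norm_satakeParameter_le_sqrt (μ := μ))
    (h₂ : summable_normSq_trace_satakePow (μ := μ)) :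
    absolutelyConvergent_partialStandardL (μ := μ) := by
  intro P S α hα s hs
  set σ := s.re with hσ
  let b : {v : HeightOneSpectrum (𝓞 K) // v ∉ S} → ℝ := fun v =>
    ‖(α v.1).sum‖ ^ 2 * (v.1.residueCard : ℝ) ^ (-σ) + (v.1.residueCard : ℝ) ^ (-σ) +
      4 ^ n * (v.1.residueCard : ℝ) ^ (1 - 2 * σ)
  have hb : Summable b := by
    refine ((?_ : Summable _).add ?_).add ?_
    · refine ((h₂ P hα hs).prod_factor 0).congr fun v => ?_
      have hq0 : (0 : ℝ) ≤ v.1.residueCard := Nat.cast_nonneg _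
      simp [Real.rpow_neg hq0, div_eq_mul_inv]
    · exact (summable_residueCard_rpow_neg hs).subtype _
    · refine (((summable_residueCard_rpow_neg (K := K) (σ := 2 * σ - 1) (by linarith)).subtype
        _).mul_left (4 ^ n)).congr fun v => ?_
      simp [neg_sub]
  refine summable_norm_inv_sub_one hb fun v => ?_
  have hcard : Multiset.card (α v.1) = n := hα.card_eq v.2
  have := norm_eval_eulerPolynomial_sub_one_le_of_sqrt v.1.one_lt_residueCard
    (fun a ha => h₁ P hα v.2 ha) (s := s) (by linarith)
  simpa [b, hcard] using this

/-- Hence `multipliable_partialStandardL` from Jacquet–Shalika's two inputs. [folklore] -/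
theorem multipliable_partialStandardL_of_JS (h₁ : norm_satakeParameter_le_sqrt (μ := μ))
    (h₂ : summable_normSq_trace_satakePow (μ := μ)) :
    multipliable_partialStandardL (μ := μ) :=
  multipliable_partialStandardL_of_absolutelyConvergent
    (absolutelyConvergent_partialStandardL_of_JS h₁ h₂)

end Cuspidal

namespace StandardLFunctionData

variable {n : ℕ} {K : Type} [Field K] [NumberField K]
  {μ : Measure (AdelicGroupData.gl n K).automorphicQuotient}
  [(AdelicGroupData.gl n K).IsAutomorphicMeasure μ] {P : CuspidalAutomorphicRepGL n K μ}

/-- **`multipliable_L` from Jacquet–Shalika's inputs**: the bound (5.1.3) on Satake parameters of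
cusp forms and the convergence (5.3.3)–(5.3.4) of `log L_S(σ, π × π̄)` for `σ > 1` imply that the
full standard Euler product of every `D : StandardLFunctionData Π` is multipliable on `re s > 1`.
[cite: JacquetShalikaAJM1981, Thm. (5.3), Remark (5.4)] -/
theorem multipliable_L_of_JS (h₁ : norm_satakeParameter_le_sqrt (μ := μ))
    (h₂ : summable_normSq_trace_satakePow (μ := μ)) : multipliable_L (P := P) :=
  multipliable_L_of_absolutelyConvergent (absolutelyConvergent_partialStandardL_of_JS h₁ h₂)

end StandardLFunctionData


/-! ### The bound (5.1.3) from the convergence (5.3.3): roots from power sums -/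

section PowerSum

open Finset Topology

/-- For `‖z‖ ≤ 1`, `z ≠ 1`: `‖∑_{j<N} z^j‖ ≤ 2 / ‖z - 1‖`. [folklore] -/
theorem norm_geom_sum_le_of_norm_le_one {z : ℂ} (hz : ‖z‖ ≤ 1) (hz1 : z ≠ 1) (N : ℕ) :
    ‖∑ j ∈ range N, z ^ j‖ ≤ 2 / ‖z - 1‖ := by
  rw [geom_sum_eq hz1, norm_div]
  refine div_le_div_of_nonneg_right ?_ (norm_nonneg _)
  calc ‖z ^ N - 1‖ ≤ ‖z ^ N‖ + ‖(1 : ℂ)‖ := norm_sub_le _ _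
    _ ≤ 1 + 1 := by
        rw [norm_pow, norm_one]
        exact add_le_add (pow_le_one₀ (norm_nonneg _) hz) le_rfl
    _ = 2 := by norm_num

/-- Cesàro means of a unimodular-or-smaller geometric sequence: for `‖z‖ ≤ 1`, `z ≠ 1`,
`(1/N) ∑_{j<N} z^j → 0`. [folklore] -/
theorem tendsto_cesaro_geom_of_ne_one {z : ℂ} (hz : ‖z‖ ≤ 1) (hz1 : z ≠ 1) :
    Tendsto (fun N : ℕ => (N : ℂ)⁻¹ * ∑ j ∈ range N, z ^ j) atTop (𝓝 0) := by
  rw [tendsto_zero_iff_norm_tendsto_zero]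
  have hz1' : 0 < ‖z - 1‖ := norm_pos_iff.mpr (sub_ne_zero.mpr hz1)
  refine squeeze_zero (fun N => norm_nonneg _)
    (fun N => show ‖(N : ℂ)⁻¹ * ∑ j ∈ range N, z ^ j‖ ≤ 2 / ‖z - 1‖ * (N : ℝ)⁻¹ from ?_) ?_
  · rw [norm_mul, norm_inv, Complex.norm_natCast, mul_comm]
    exact mul_le_mul_of_nonneg_right (norm_geom_sum_le_of_norm_le_one hz hz1 N)
      (inv_nonneg.mpr (Nat.cast_nonneg N))
  · simpa using (tendsto_inv_atTop_nhds_zero_nat (𝕜 := ℝ)).const_mul (2 / ‖z - 1‖)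

/-- `(1/N) ∑_{j<N} 1^j → 1`. [folklore] -/
theorem tendsto_cesaro_geom_one :
    Tendsto (fun N : ℕ => (N : ℂ)⁻¹ * ∑ j ∈ range N, (1 : ℂ) ^ j) atTop (𝓝 1) := by
  refine tendsto_const_nhds.congr' ?_
  filter_upwards [eventually_ne_atTop 0] with N hN
  simp only [one_pow, sum_const, card_range, nsmul_eq_mul, mul_one]
  rw [inv_mul_cancel₀ (Nat.cast_ne_zero.mpr hN)]

/-- `∑_{i,i'} (v_i \bar v_{i'})^j = |p_j(v)|²`, `p_j(v) = ∑_i v_i^j`. [folklore] -/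
theorem sum_sum_mul_conj_pow {ι : Type*} [Fintype ι] (v : ι → ℂ) (j : ℕ) :
    ∑ i, ∑ i', (v i * (starRingEnd ℂ) (v i')) ^ j = ((‖∑ i, v i ^ j‖ : ℝ) : ℂ) ^ 2 := by
  rw [← Complex.mul_conj', map_sum, Finset.sum_mul_sum]
  refine Finset.sum_congr rfl fun i _ => Finset.sum_congr rfl fun i' _ => ?_
  rw [mul_pow, map_pow]

/-- **Root bound from power-sum bounds.** If the power sums `p_j = ∑_i v_i^j` of finitely many
complex numbers satisfy `|p_j|² ≤ A j^d R^{2j}` for all `j ≥ 1`, then `|v_i| ≤ R` for every `i`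
(equivalently `limsup |p_j|^{1/j} = max_i |v_i|`). Proof: with `ρ = max_i |v_i|`, the Cesàro
means of `|p_j|² / ρ^{2j} = ∑_{i,i'} (v_i \bar v_{i'} / ρ²)^j` tend to the number of pairs with
`v_i \bar v_{i'} = ρ²`, which is `≥ 1`, so `|p_j|² / ρ^{2j} ↛ 0` and `ρ ≤ R`. [folklore] -/
theorem norm_le_of_normSq_powerSum_le {ι : Type*} [Fintype ι] (v : ι → ℂ) {A R : ℝ} {d : ℕ}
    (hR : 0 ≤ R) (h : ∀ j : ℕ, 0 < j → ‖∑ i, v i ^ j‖ ^ 2 ≤ A * (j : ℝ) ^ d * R ^ (2 * j))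
    (i₀ : ι) : ‖v i₀‖ ≤ R := by
  classical
  by_contra! hlt
  obtain ⟨m, -, hm⟩ :=
    Finset.exists_max_image Finset.univ (fun i => ‖v i‖) ⟨i₀, Finset.mem_univ _⟩
  set ρ : ℝ := ‖v m‖ with hρ
  have hle : ∀ i, ‖v i‖ ≤ ρ := fun i => hm i (Finset.mem_univ _)
  have hρR : R < ρ := hlt.trans_le (hle i₀)
  have hρ0 : 0 < ρ := hR.trans_lt hρR
  have hρc : ((ρ : ℂ)) ^ 2 ≠ 0 := pow_ne_zero _ (Complex.ofReal_ne_zero.mpr hρ0.ne')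
  -- the normalised pair products
  set z : ι → ι → ℂ := fun i i' => v i * (starRingEnd ℂ) (v i') / (ρ : ℂ) ^ 2 with hz
  have hz_norm : ∀ i i', ‖z i i'‖ ≤ 1 := by
    intro i i'
    rw [hz, norm_div, norm_mul, Complex.norm_conj, norm_pow, Complex.norm_real,
      Real.norm_of_nonneg hρ0.le, div_le_one (by positivity), sq]
    exact mul_le_mul (hle i) (hle i') (norm_nonneg _) hρ0.le
  have hz_mm : z m m = 1 := by
    rw [hz]
    dsimp only
    rw [Complex.mul_conj', ← hρ, div_self hρc]
  -- `x j = |p_j|² / ρ^{2j}` as a complex number, and its expansion over pairs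
  set x : ℕ → ℂ := fun j => ((‖∑ i, v i ^ j‖ : ℝ) : ℂ) ^ 2 / ((ρ : ℂ) ^ 2) ^ j with hx
  have hxj : ∀ j, ∑ i, ∑ i', z i i' ^ j = x j := by
    intro j
    simp only [hz, hx, div_pow, ← Finset.sum_div, sum_sum_mul_conj_pow]
  -- `x j → 0` by the hypothesis, since `R < ρ`
  have hx0 : Tendsto x atTop (𝓝 0) := by
    rw [tendsto_zero_iff_norm_tendsto_zero]
    have hr : |R ^ 2 / ρ ^ 2| < 1 := by
      rw [abs_of_nonneg (by positivity), div_lt_one (by positivity)]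
      exact pow_lt_pow_left₀ hρR hR two_ne_zero
    refine squeeze_zero' (Eventually.of_forall fun j => norm_nonneg _) ?_
      (by simpa using (tendsto_pow_const_mul_const_pow_of_abs_lt_one d hr).const_mul A)
    filter_upwards [eventually_gt_atTop 0] with j hj
    rw [hx]
    dsimp only
    rw [norm_div, norm_pow, norm_pow, norm_pow, Complex.norm_real, Complex.norm_real,
      Real.norm_of_nonneg (norm_nonneg _), Real.norm_of_nonneg hρ0.le, div_pow, ← pow_mul,
      ← pow_mul, div_le_iff₀ (by positivity)]
    calc ‖∑ i, v i ^ j‖ ^ 2 ≤ A * (j : ℝ) ^ d * R ^ (2 * j) := h j hj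
      _ = A * ((j : ℝ) ^ d * (R ^ (2 * j) / ρ ^ (2 * j))) * ρ ^ (2 * j) := by
          field_simp
  -- Cesàro means: on the one hand `→ 0` ...
  have hS0 : Tendsto (fun N : ℕ => ∑ i, ∑ i', (N : ℂ)⁻¹ * ∑ j ∈ range N, z i i' ^ j)
      atTop (𝓝 0) := by
    refine hx0.cesaro_smul.congr fun N => ?_
    rw [Complex.real_smul, Complex.ofReal_inv, Complex.ofReal_natCast, Finset.mul_sum]
    simp only [← hxj, Finset.mul_sum]
    rw [Finset.sum_comm]
    refine Finset.sum_congr rfl fun i _ => ?_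
    rw [Finset.sum_comm]
  -- ... on the other hand `→ #{(i,i') : z i i' = 1} ≥ 1`
  have hS : Tendsto (fun N : ℕ => ∑ i, ∑ i', (N : ℂ)⁻¹ * ∑ j ∈ range N, z i i' ^ j)
      atTop (𝓝 (∑ i, ∑ i', if z i i' = 1 then (1 : ℂ) else 0)) := by
    refine tendsto_finsetSum _ fun i _ => tendsto_finsetSum _ fun i' _ => ?_
    split_ifs with h1
    · rw [h1]; exact tendsto_cesaro_geom_one
    · exact tendsto_cesaro_geom_of_ne_one (hz_norm i i') h1
  have hL := congrArg Complex.re (tendsto_nhds_unique hS hS0)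
  simp only [Complex.re_sum, apply_ite Complex.re, Complex.one_re, Complex.zero_re] at hL
  have h1 : (1 : ℝ) ≤ ∑ i, ∑ i', if z i i' = 1 then (1 : ℝ) else 0 :=
    calc (1 : ℝ) = if z m m = 1 then (1 : ℝ) else 0 := by rw [if_pos hz_mm]
      _ ≤ ∑ i', if z m i' = 1 then (1 : ℝ) else 0 :=
          Finset.single_le_sum (f := fun i' => if z m i' = 1 then (1 : ℝ) else 0)
            (fun i' _ => by positivity) (Finset.mem_univ m)
      _ ≤ ∑ i, ∑ i', if z i i' = 1 then (1 : ℝ) else 0 :=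
          Finset.single_le_sum (f := fun i => ∑ i', if z i i' = 1 then (1 : ℝ) else 0)
            (fun i _ => Finset.sum_nonneg fun i' _ => by positivity) (Finset.mem_univ m)
  linarith

/-- Multiset form of `norm_le_of_normSq_powerSum_le`: if `|∑_{a ∈ α} a^j|² ≤ A j^d R^{2j}` for
all `j ≥ 1`, then `|a| ≤ R` for every `a ∈ α`. [folklore] -/
theorem norm_le_of_mem_of_normSq_powerSum_le (α : Multiset ℂ) {A R : ℝ} {d : ℕ} (hR : 0 ≤ R)
    (h : ∀ j : ℕ, 0 < j → ‖(α.map (· ^ j)).sum‖ ^ 2 ≤ A * (j : ℝ) ^ d * R ^ (2 * j)) {a : ℂ}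
    (ha : a ∈ α) : ‖a‖ ≤ R := by
  induction α using Quotient.inductionOn with
  | h l =>
    rw [Multiset.quot_mk_to_coe, Multiset.mem_coe] at ha
    obtain ⟨i, hi, rfl⟩ := List.getElem_of_mem ha
    refine norm_le_of_normSq_powerSum_le (fun i : Fin l.length => l[i.1]) (A := A) (d := d) hR
      (fun j hj => ?_) ⟨i, hi⟩
    have := h j hj
    rwa [Multiset.quot_mk_to_coe, Multiset.map_coe, Multiset.sum_coe,
      ← Fin.sum_univ_fun_getElem] at this

end PowerSum

section Cuspidal

variable {n : ℕ} {K : Type} [Field K] [NumberField K]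
  {μ : Measure (AdelicGroupData.gl n K).automorphicQuotient}
  [(AdelicGroupData.gl n K).IsAutomorphicMeasure μ]

open Topology in
/-- **(5.3.3) bounds the Satake parameters.** If the series (5.3.3)–(5.3.4)
`∑_{v ∉ S} ∑_{k ≥ 1} |tr A_v^k|² / (k q_v^{kσ})` of a cuspidal `Π` converges at some `σ > 1`
(`summable_normSq_trace_satakePow`), then every Satake parameter `a ∈ α v`, `v ∉ S`, satisfies
`|a| ≤ q_v^{σ/2}`: the terms of a convergent series of non-negative reals are bounded by its sum
`T`, so `|tr A_v^j|² ≤ T j q_v^{jσ} = T j (q_v^{σ/2})^{2j}` for `j ≥ 1`, and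
`norm_le_of_mem_of_normSq_powerSum_le` applies. [folklore] -/
theorem norm_satakeParameter_le_rpow_of_summable (h₂ : summable_normSq_trace_satakePow (μ := μ))
    (P : CuspidalAutomorphicRepGL n K μ) {S : Set (HeightOneSpectrum (𝓞 K))} {α : SatakeFamily K}
    (hα : IsSatakeFamilyOf P S α) {v : HeightOneSpectrum (𝓞 K)} (hv : v ∉ S) {a : ℂ}
    (ha : a ∈ α v) {σ : ℝ} (hσ : 1 < σ) : ‖a‖ ≤ (v.residueCard : ℝ) ^ (σ / 2) := by
  have hs := h₂ P hα hσ
  have hq0 : (0 : ℝ) < v.residueCard := by exact_mod_cast (zero_lt_one.trans v.one_lt_residueCard)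
  set F : ℕ × {v : HeightOneSpectrum (𝓞 K) // v ∉ S} → ℝ := fun kv =>
      ‖((α kv.2.1).map (· ^ (kv.1 + 1))).sum‖ ^ 2 /
        ((kv.1 + 1 : ℝ) * (kv.2.1.residueCard : ℝ) ^ ((kv.1 + 1 : ℝ) * σ)) with hF
  have hF0 : ∀ kv, 0 ≤ F kv := fun kv => by positivity
  refine norm_le_of_mem_of_normSq_powerSum_le (α v) (A := ∑' kv, F kv) (d := 1)
    (Real.rpow_nonneg hq0.le _) (fun j hj => ?_) ha
  obtain ⟨k, rfl⟩ : ∃ k, j = k + 1 := ⟨j - 1, by omega⟩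
  have hle : ‖((α v).map (· ^ (k + 1))).sum‖ ^ 2 /
      ((k + 1 : ℝ) * (v.residueCard : ℝ) ^ ((k + 1 : ℝ) * σ)) ≤ ∑' kv, F kv :=
    hs.le_tsum (k, ⟨v, hv⟩) fun kv _ => hF0 kv
  have hpos : (0 : ℝ) < (k + 1 : ℝ) * (v.residueCard : ℝ) ^ ((k + 1 : ℝ) * σ) := by positivity
  have hexp : ((v.residueCard : ℝ) ^ (σ / 2)) ^ (2 * (k + 1)) =
      (v.residueCard : ℝ) ^ ((k + 1 : ℝ) * σ) := by
    rw [← Real.rpow_natCast, ← Real.rpow_mul hq0.le]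
    congr 1
    push_cast
    ring
  calc ‖((α v).map (· ^ (k + 1))).sum‖ ^ 2
        ≤ (∑' kv, F kv) * ((k + 1 : ℝ) * (v.residueCard : ℝ) ^ ((k + 1 : ℝ) * σ)) :=
          (div_le_iff₀ hpos).mp hle
    _ = _ := by
          rw [pow_one, hexp]
          push_cast
          ring

open Topology in
/-- **(5.3.3)–(5.3.4) imply (5.1.3).** The convergence of
`∑_{v ∉ S} ∑_{k ≥ 1} |tr A_v^k|² / (k q_v^{kσ})` for every `σ > 1`
(`summable_normSq_trace_satakePow`, Jacquet–Shalika (1981), (5.3.3)–(5.3.4)) implies the bound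
`|μ_{j,v}| ≤ q_v^{1/2}` on the Satake parameters of a cusp form at the unramified places
(`norm_satakeParameter_le_sqrt`, loc. cit. (5.1.3)): `|μ_{j,v}| ≤ q_v^{σ/2}` for every `σ > 1`
(`norm_satakeParameter_le_rpow_of_summable`), and `σ ↦ q_v^{σ/2}` is continuous at `σ = 1`
(the classical remark that the convergence of `L_S(s, π × π̄)` on `re s > 1` already bounds the
local parameters by `q_v^{1/2}`). [folklore] -/
theorem norm_satakeParameter_le_sqrt_of_summable (h₂ : summable_normSq_trace_satakePow (μ := μ)) :
    norm_satakeParameter_le_sqrt (μ := μ) := by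
  intro P S α hα v hv a ha
  have hq0 : (0 : ℝ) < v.residueCard := by exact_mod_cast (zero_lt_one.trans v.one_lt_residueCard)
  have hlim : Tendsto (fun σ : ℝ => (v.residueCard : ℝ) ^ (σ / 2)) (𝓝[>] 1)
      (𝓝 ((v.residueCard : ℝ) ^ ((1 : ℝ) / 2))) :=
    (((Real.continuousAt_const_rpow hq0.ne').comp (continuousAt_id.div_const 2)).tendsto).mono_left
      nhdsWithin_le_nhds
  rw [Real.sqrt_eq_rpow]
  exact ge_of_tendsto hlim (eventually_nhdsWithin_of_forall fun σ hσ =>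
    norm_satakeParameter_le_rpow_of_summable h₂ P hα hv ha hσ)

/-- **Jacquet–Shalika's Thm. (5.3) (case `π' = 1`) from the single input (5.3.3)–(5.3.4).** The
convergence of `∑_{v ∉ S} ∑_{k ≥ 1} |tr A_v^k|² / (k q_v^{kσ})` for `σ > 1`
(`summable_normSq_trace_satakePow`) implies the absolute convergence
`∑_{v ∉ S} ‖L(s, Π_v) - 1‖ < ∞` of the partial standard Euler product on `re s > 1`
(`absolutelyConvergent_partialStandardL`): the bound (5.1.3) it requires is itself a consequence
(`norm_satakeParameter_le_sqrt_of_summable`), and the rest is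
`absolutelyConvergent_partialStandardL_of_JS`.
[cite: JacquetShalikaAJM1981, Thm. (5.3), Remark (5.4)] -/
theorem absolutelyConvergent_partialStandardL_of_summable
    (h₂ : summable_normSq_trace_satakePow (μ := μ)) :
    absolutelyConvergent_partialStandardL (μ := μ) :=
  absolutelyConvergent_partialStandardL_of_JS (norm_satakeParameter_le_sqrt_of_summable h₂) h₂

/-- Hence `multipliable_partialStandardL` from the single input (5.3.3)–(5.3.4). [folklore] -/
theorem multipliable_partialStandardL_of_summable
    (h₂ : summable_normSq_trace_satakePow (μ := μ)) : multipliable_partialStandardL (μ := μ) :=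
  multipliable_partialStandardL_of_absolutelyConvergent
    (absolutelyConvergent_partialStandardL_of_summable h₂)

/-- A single Euler factor does not vanish on `re s > 1/2` under the bound (5.1.3): if all
`a ∈ α` have `‖a‖ ≤ q^{1/2}` and `re s > 1/2`, then `∏_{a ∈ α} (1 - a q^{-s}) ≠ 0`, each factor
having `‖a q^{-s}‖ ≤ q^{1/2 - re s} < 1` (Jacquet–Shalika (1981), proof of Thm. (5.3), p. 555:
"the individual terms in this finite product are of the form `(1 - z)⁻¹` with `|z| < 1`").
[folklore] -/
theorem eval_eulerPolynomial_ne_zero_of_sqrt {α : Multiset ℂ} {q : ℕ} (hq : 1 < q)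
    (hα : ∀ a ∈ α, ‖a‖ ≤ Real.sqrt q) {s : ℂ} (hs : 1 / 2 < s.re) :
    (eulerPolynomial α).eval ((q : ℂ) ^ (-s)) ≠ 0 := by
  rw [eval_eulerPolynomial]
  refine Multiset.prod_ne_zero fun h0 => ?_
  obtain ⟨a, ha, h⟩ := Multiset.mem_map.mp h0
  have hq0 : (0 : ℝ) < q := by exact_mod_cast (zero_lt_one.trans hq)
  have hlt : ‖a * (q : ℂ) ^ (-s)‖ < 1 := by
    rw [norm_mul, norm_natCast_cpow_of_pos (zero_lt_one.trans hq), neg_re]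
    calc ‖a‖ * (q : ℝ) ^ (-s.re) ≤ Real.sqrt q * (q : ℝ) ^ (-s.re) := by
          gcongr
          exact hα a ha
      _ = (q : ℝ) ^ (1 / 2 - s.re) := by
          rw [Real.sqrt_eq_rpow, ← Real.rpow_add hq0]
          ring_nf
      _ < 1 := Real.rpow_lt_one_of_one_lt_of_neg (by exact_mod_cast hq) (by linarith)
  have h1 : a * (q : ℂ) ^ (-s) = 1 := (sub_eq_zero.mp h).symm
  rw [h1, norm_one] at hlt
  exact lt_irrefl _ hlt

/-- **Jacquet–Shalika, Thm. (5.3), "in particular": non-vanishing of `L_S(s, π)` on `re s > 1`**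
from the single input (5.3.3)–(5.3.4). For a cuspidal `Π` with Satake family `α` off `S` and
`re s > 1`, the partial standard L-function `L^S(s, Π) = ∏_{v ∉ S} (∏_{a ∈ α v}(1 - a q_v^{-s}))⁻¹`
(`partialStandardL`, a genuine value here) is non-zero: the product converges absolutely
(`absolutelyConvergent_partialStandardL_of_summable`) and no factor vanishes
(`eval_eulerPolynomial_ne_zero_of_sqrt` with `norm_satakeParameter_le_sqrt_of_summable`), and an
absolutely convergent product of non-zero factors in `ℂ` is non-zero (Mathlib
`tprod_one_add_ne_zero_of_summable`; loc. cit. p. 555: "the infinite product … is absolutely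
convergent in the half-plane `Re(s) > 1`. In particular the function `L_S(s, π × π')` does not
vanish for `Re(s) > 1`", case `π' = 1` of Remark (5.4)).
[cite: JacquetShalikaAJM1981, Thm. (5.3), Remark (5.4)] -/
theorem partialStandardL_ne_zero_of_summable (h₂ : summable_normSq_trace_satakePow (μ := μ))
    (P : CuspidalAutomorphicRepGL n K μ) {S : Set (HeightOneSpectrum (𝓞 K))} {α : SatakeFamily K}
    (hα : IsSatakeFamilyOf P S α) {s : ℂ} (hs : 1 < s.re) : partialStandardL S α s ≠ 0 := by
  have habs := absolutelyConvergent_partialStandardL_of_summable h₂ P hα hs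
  have hne : ∀ v : {v : HeightOneSpectrum (𝓞 K) // v ∉ S},
      1 + (((eulerPolynomial (α v.1)).eval ((v.1.residueCard : ℂ) ^ (-s)))⁻¹ - 1) ≠ 0 := by
    intro v
    rw [add_sub_cancel, ne_eq, inv_eq_zero]
    exact eval_eulerPolynomial_ne_zero_of_sqrt v.1.one_lt_residueCard
      (fun a ha => norm_satakeParameter_le_sqrt_of_summable h₂ P hα v.2 ha) (by linarith)
  have := tprod_one_add_ne_zero_of_summable hne habs
  unfold partialStandardL
  simpa only [add_sub_cancel] using this

end Cuspidal

namespace StandardLFunctionData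

variable {n : ℕ} {K : Type} [Field K] [NumberField K]
  {μ : Measure (AdelicGroupData.gl n K).automorphicQuotient}
  [(AdelicGroupData.gl n K).IsAutomorphicMeasure μ] {P : CuspidalAutomorphicRepGL n K μ}

/-- **`multipliable_L` from the single input (5.3.3)–(5.3.4).** The convergence of
`log L_S(σ, π × π̄) = ∑_{v ∉ S} ∑_{k ≥ 1} |tr A_v^k|² / (k q_v^{kσ})` for `σ > 1`
(`summable_normSq_trace_satakePow`, Jacquet–Shalika (1981), (5.3.3)–(5.3.4), in print from
Lemma (5.2) and Landau's lemma) implies that the full standard Euler product of every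
`D : StandardLFunctionData Π` is multipliable on `re s > 1` (`multipliable_L`).
[cite: JacquetShalikaAJM1981, Thm. (5.3), Remark (5.4)] -/
theorem multipliable_L_of_summable (h₂ : summable_normSq_trace_satakePow (μ := μ)) :
    multipliable_L (P := P) :=
  multipliable_L_of_absolutelyConvergent (absolutelyConvergent_partialStandardL_of_summable h₂)

/-- **`L(s, Π) = (∏_{v ∈ S} P_v(q_v^{-s})⁻¹) · L^S(s, Π)` on `re s > 1`** (the named fact
`L_eq_partialStandardL_mul` of `AutomorphicLFunction`) follows from the multipliability of the
partial standard Euler product (`multipliable_partialStandardL`): a `tprod` over all finite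
places whose restrictions to the finite set `D.S` and to its complement are multipliable is the
product of the two restricted `tprod`s (Mathlib `Multipliable.tprod_mul_tprod_compl`,
`Finset.tprod_subtype`), and off `D.S` the local factors of `D` are the Satake Euler polynomials
(`localFactor_of_not_mem`). [folklore] -/
theorem L_eq_partialStandardL_mul_of_multipliable_partialStandardL
    (h : multipliable_partialStandardL (μ := μ)) : L_eq_partialStandardL_mul (P := P) := by
  intro D s hs
  have hfin := D.S.multipliable fun v : HeightOneSpectrum (𝓞 K) =>
    ((D.localFactor v).eval ((v.residueCard : ℂ) ^ (-s)))⁻¹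
  have hpart : Multipliable ((fun v : HeightOneSpectrum (𝓞 K) =>
      ((D.localFactor v).eval ((v.residueCard : ℂ) ^ (-s)))⁻¹) ∘
        ((↑) : ↥((↑D.S : Set (HeightOneSpectrum (𝓞 K)))ᶜ) → HeightOneSpectrum (𝓞 K))) := by
    refine (h P D.isSatakeFamily (s := s) hs).congr fun v => ?_
    simp only [Function.comp_apply, D.localFactor_of_not_mem v.1 (by simpa using v.2)]
  rw [StandardLFunctionData.L, ← hfin.tprod_mul_tprod_compl hpart]
  congr 1
  · exact Finset.tprod_subtype' D.S fun v : HeightOneSpectrum (𝓞 K) =>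
      ((D.localFactor v).eval ((v.residueCard : ℂ) ^ (-s)))⁻¹
  · unfold partialStandardL
    exact tprod_congr fun v => by
      rw [D.localFactor_of_not_mem v.1
        (by simpa only [Set.mem_compl_iff, Finset.mem_coe] using v.2)]

/-- Hence `L_eq_partialStandardL_mul` from the single input (5.3.3)–(5.3.4)
(`summable_normSq_trace_satakePow`). [cite: JacquetShalikaAJM1981, Thm. (5.3), Remark (5.4)] -/
theorem L_eq_partialStandardL_mul_of_summable (h₂ : summable_normSq_trace_satakePow (μ := μ)) :
    L_eq_partialStandardL_mul (P := P) :=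
  L_eq_partialStandardL_mul_of_multipliable_partialStandardL
    (multipliable_partialStandardL_of_summable h₂)

end StandardLFunctionData

end Literature.NumberTheory.Automorphic
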